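import Mathlib

/-!
# Kernel-checked core of the doubling lemma (idea `odd-persistence-light-cone`, crux stmt-AtomisticToContinuum-9139)

For a one-parameter group of linear isometries `U` of a real inner-product space, an isometry `Θ` with
`Θ ∘ U_t = U_{-t} ∘ Θ`, and an odd vector `F` (`Θ F = -F`):
* `odd_norm_sq` : `‖U_t F - Θ (U_t F)‖² = 2‖F‖² + 2⟪U_{2t} F, F⟫`;
* `odd_dichotomy` : for every `t`, either `‖F‖²/16 ≤ ‖½(U_tF - ΘU_tF)‖²` or `11‖F‖²/16 ≤ ‖½(U_{2t}F - ΘU_{2t}F)‖²;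
* `odd_sum_ge` : hence `f(t) + f(2t) ≥ ‖F‖/4` for the half-norm `f` of the odd part;
* `odd_persistence_integral`, `oddPersistence_holds` : **the card's First lemma `OddPersistence`, PROVED** —
  `t₀‖F‖/12 ≤ ∫₀^{t₀} ‖U_tF - ΘU_tF‖/2 dt` for every `t₀ ≥ 0` (integrate `f(t) + f(2t) ≥ ‖F‖/4` over `[0, t₀/2]`
  and substitute `s = 2t`: `∫₀^{t₀} f + ½∫₀^{t₀} f ≥ t₀‖F‖/8`).
No mixing, no spectral theorem, no Bochner: Hilbert-space algebra plus one linear change of variables.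
(lean check rc 0, 0 sorry; axioms propext / Classical.choice / Quot.sound.)
-/

open scoped RealInnerProductSpace

namespace Summit.AtomisticToContinuum.FouriersLaw.Cruxes.OddCorrectorDecay.OddPersistenceLightCone

variable {E : Type*} [NormedAddCommGroup E] [InnerProductSpace ℝ E]

section

variable (U : ℝ → E →ₗᵢ[ℝ] E) (Θ : E →ₗᵢ[ℝ] E) (F : E)
  (hU0 : ∀ x, U 0 x = x) (hUadd : ∀ s t x, U (s + t) x = U s (U t x))
  (hrev : ∀ t x, Θ (U t x) = U (-t) (Θ x)) (hodd : Θ F = -F)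

include hU0 hUadd hrev hodd

/-- The odd part of `U_t F` is `½(U_t F + U_{-t} F)`. -/
theorem odd_part_eq (t : ℝ) : U t F - Θ (U t F) = U t F + U (-t) F := by
  rw [hrev, hodd, LinearIsometry.map_neg, sub_neg_eq_add]

/-- `⟪U_t F, U_{-t} F⟫ = ⟪U_{2t} F, F⟫` (isometry + group law). -/
theorem inner_forward_backward (t : ℝ) : ⟪U t F, U (-t) F⟫ = ⟪U (2 * t) F, F⟫ := by
  have h1 : U t (U t F) = U (2 * t) F := by rw [← hUadd]; ring_nf
  have h2 : U t (U (-t) F) = F := by rw [← hUadd]; simp [hU0]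
  calc ⟪U t F, U (-t) F⟫ = ⟪U t (U t F), U t (U (-t) F)⟫ := ((U t).inner_map_map _ _).symm
    _ = ⟪U (2 * t) F, F⟫ := by rw [h1, h2]

/-- **Odd-norm identity**: `‖U_t F - Θ U_t F‖² = 2‖F‖² + 2⟪U_{2t}F, F⟫`. -/
theorem odd_norm_sq (t : ℝ) :
    ‖U t F - Θ (U t F)‖ ^ 2 = 2 * ‖F‖ ^ 2 + 2 * ⟪U (2 * t) F, F⟫ := by
  rw [odd_part_eq U Θ F hU0 hUadd hrev hodd, norm_add_sq_real, inner_forward_backward U Θ F hU0 hUadd hrev hodd,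
    LinearIsometry.norm_map, LinearIsometry.norm_map]
  ring

/-- **Doubling dichotomy**: for every `t`, either the odd part at `t` has squared norm `≥ ‖F‖²/16`,
or the odd part at `2t` has squared norm `≥ 11‖F‖²/16`. -/
theorem odd_dichotomy (t : ℝ) :
    ‖F‖ ^ 2 / 16 ≤ ‖U t F - Θ (U t F)‖ ^ 2 / 4 ∨
      11 * ‖F‖ ^ 2 / 16 ≤ ‖U (2 * t) F - Θ (U (2 * t) F)‖ ^ 2 / 4 := by
  set a : ℝ := ‖F‖ ^ 2 with ha
  set c₂ : ℝ := ⟪U (2 * t) F, F⟫ with hc₂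
  have h_t := odd_norm_sq U Θ F hU0 hUadd hrev hodd t
  by_cases hc : -(7 / 8) * a ≤ c₂
  · left
    rw [h_t]
    nlinarith [hc]
  · right
    push Not at hc
    have h_2t := odd_norm_sq U Θ F hU0 hUadd hrev hodd (2 * t)
    -- e := U_{2t} F + F has ‖e‖² = 2a + 2c₂ < a/4
    set e : E := U (2 * t) F + F with he
    have he_sq : ‖e‖ ^ 2 = 2 * a + 2 * c₂ := by
      rw [he, norm_add_sq_real, LinearIsometry.norm_map, ← ha, ← hc₂]
      ring
    have he_lt : ‖e‖ ^ 2 < a / 4 := by rw [he_sq]; linarith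
    have he_norm : ‖e‖ < ‖F‖ / 2 := by
      have h0 : 0 ≤ ‖F‖ / 2 := by positivity
      nlinarith [norm_nonneg e, he_lt, ha]
    -- c₄ = ⟪U_{2t} e, F⟫ - c₂
    have hUF : U (2 * t) F = e - F := by rw [he]; abel
    have hc4 : ⟪U (2 * (2 * t)) F, F⟫ = ⟪U (2 * t) e, F⟫ - c₂ := by
      have h4 : U (2 * (2 * t)) F = U (2 * t) (U (2 * t) F) := by rw [← hUadd]; ring_nf
      rw [h4, hUF, map_sub, inner_sub_left, ← hc₂]
    have hbound : |⟪U (2 * t) e, F⟫| ≤ ‖e‖ * ‖F‖ := by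
      have := abs_real_inner_le_norm (U (2 * t) e) F
      rwa [LinearIsometry.norm_map] at this
    have habs := abs_le.mp hbound
    have hprod : ‖e‖ * ‖F‖ ≤ a / 2 := by
      have hF : 0 ≤ ‖F‖ := norm_nonneg F
      calc ‖e‖ * ‖F‖ ≤ (‖F‖ / 2) * ‖F‖ := by exact mul_le_mul_of_nonneg_right he_norm.le hF
        _ = a / 2 := by rw [ha]; ring
    rw [h_2t, hc4]
    nlinarith [habs.1, hprod, hc]

/-- Pointwise consequence: `f(t) + f(2t) ≥ ‖F‖/4` for the half-norm `f(t) = ‖U_tF - ΘU_tF‖/2` of the odd part. -/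
theorem odd_sum_ge (t : ℝ) :
    ‖F‖ / 4 ≤ ‖U t F - Θ (U t F)‖ / 2 + ‖U (2 * t) F - Θ (U (2 * t) F)‖ / 2 := by
  have hF : 0 ≤ ‖F‖ / 4 := by positivity
  have h1 : 0 ≤ ‖U t F - Θ (U t F)‖ / 2 := by positivity
  have h2 : 0 ≤ ‖U (2 * t) F - Θ (U (2 * t) F)‖ / 2 := by positivity
  rcases odd_dichotomy U Θ F hU0 hUadd hrev hodd t with h | h
  · have hsq : (‖F‖ / 4) ^ 2 ≤ (‖U t F - Θ (U t F)‖ / 2) ^ 2 := by nlinarith [h]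
    exact le_of_sq_le_sq hsq h1 |>.trans (le_add_of_nonneg_right h2)
  · have hsq : (‖F‖ / 4) ^ 2 ≤ (‖U (2 * t) F - Θ (U (2 * t) F)‖ / 2) ^ 2 := by
      nlinarith [h, sq_nonneg ‖F‖]
    exact le_of_sq_le_sq hsq h2 |>.trans (le_add_of_nonneg_left h1)

/-- **The doubling lemma, integrated form (= the card's First lemma `OddPersistence`)**:
`t₀ ‖F‖ / 12 ≤ ∫₀^{t₀} ‖U_tF - ΘU_tF‖/2 dt` for every `t₀ ≥ 0`, assuming only continuity of the orbit.
Proof: integrate `f(t) + f(2t) ≥ ‖F‖/4` over `[0, t₀/2]` and substitute `s = 2t` in the second term: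
`∫₀^{t₀} f + ½∫₀^{t₀} f ≥ t₀‖F‖/8`. -/
theorem odd_persistence_integral (hcont : Continuous fun t => U t F) {t₀ : ℝ} (ht₀ : 0 ≤ t₀) :
    t₀ * ‖F‖ / 12 ≤ ∫ t in (0:ℝ)..t₀, ‖U t F - Θ (U t F)‖ / 2 := by
  set f : ℝ → ℝ := fun t => ‖U t F - Θ (U t F)‖ / 2 with hf
  have hfc : Continuous f := by
    have h1 : Continuous fun t => Θ (U t F) := Θ.continuous.comp hcont
    exact ((hcont.sub h1).norm).div_const 2
  have hf2c : Continuous fun t => f (2 * t) := hfc.comp (continuous_const.mul continuous_id)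
  have hnn : ∀ t, 0 ≤ f t := fun t => by positivity
  -- (1) pointwise bound integrated over [0, t₀/2]
  have hpt : ∀ t ∈ Set.Icc (0:ℝ) (t₀ / 2), ‖F‖ / 4 ≤ f t + f (2 * t) := fun t _ =>
    odd_sum_ge U Θ F hU0 hUadd hrev hodd t
  have hI1 : ∫ t in (0:ℝ)..(t₀ / 2), ‖F‖ / 4 ≤ ∫ t in (0:ℝ)..(t₀ / 2), (f t + f (2 * t)) := by
    refine intervalIntegral.integral_mono_on (by linarith) ?_ ?_ hpt
    · exact intervalIntegrable_const
    · exact (hfc.add hf2c).intervalIntegrable _ _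
  have hconst : ∫ t in (0:ℝ)..(t₀ / 2), ‖F‖ / 4 = (t₀ / 2) * (‖F‖ / 4) := by
    rw [intervalIntegral.integral_const]; simp
  -- (2) split the sum and substitute in the second integral
  have hsplit : ∫ t in (0:ℝ)..(t₀ / 2), (f t + f (2 * t)) =
      (∫ t in (0:ℝ)..(t₀ / 2), f t) + ∫ t in (0:ℝ)..(t₀ / 2), f (2 * t) :=
    intervalIntegral.integral_add (hfc.intervalIntegrable _ _) (hf2c.intervalIntegrable _ _)
  have hsubst : ∫ t in (0:ℝ)..(t₀ / 2), f (2 * t) = (1 / 2) * ∫ t in (0:ℝ)..t₀, f t := by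
    have h := intervalIntegral.integral_comp_mul_left f (two_ne_zero : (2:ℝ) ≠ 0) (a := 0) (b := t₀ / 2)
    rw [h]
    have : (2:ℝ) * (t₀ / 2) = t₀ := by ring
    rw [mul_zero, this, smul_eq_mul]
    norm_num
  -- (3) the half-interval integral is at most the full one (f ≥ 0)
  have hmono : ∫ t in (0:ℝ)..(t₀ / 2), f t ≤ ∫ t in (0:ℝ)..t₀, f t := by
    refine intervalIntegral.integral_mono_interval le_rfl (by linarith) (by linarith) ?_ (hfc.intervalIntegrable _ _)
    exact Filter.Eventually.of_forall fun t => hnn t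
  -- (4) conclude
  have key : (t₀ / 2) * (‖F‖ / 4) ≤ (∫ t in (0:ℝ)..t₀, f t) + (1 / 2) * ∫ t in (0:ℝ)..t₀, f t := by
    calc (t₀ / 2) * (‖F‖ / 4) = ∫ t in (0:ℝ)..(t₀ / 2), ‖F‖ / 4 := hconst.symm
      _ ≤ ∫ t in (0:ℝ)..(t₀ / 2), (f t + f (2 * t)) := hI1
      _ = (∫ t in (0:ℝ)..(t₀ / 2), f t) + ∫ t in (0:ℝ)..(t₀ / 2), f (2 * t) := hsplit
      _ ≤ (∫ t in (0:ℝ)..t₀, f t) + (1 / 2) * ∫ t in (0:ℝ)..t₀, f t := by rw [hsubst]; linarith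
  have : t₀ * ‖F‖ / 12 ≤ ∫ t in (0:ℝ)..t₀, f t := by nlinarith [key]
  simpa [hf] using this

end

/-- The card's First lemma, verbatim (as in Sketch.lean `OddPersistence`), PROVED. -/
theorem oddPersistence_holds :
    ∀ (E : Type) [NormedAddCommGroup E] [InnerProductSpace ℝ E]
      (U : ℝ → E →ₗᵢ[ℝ] E) (Θ : E →ₗᵢ[ℝ] E) (F : E),
      (∀ x, U 0 x = x) → (∀ s t x, U (s + t) x = U s (U t x)) →
      (∀ t x, Θ (U t x) = U (-t) (Θ x)) → Θ F = -F → Continuous (fun t => U t F) →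
      ∀ t₀ : ℝ, 0 ≤ t₀ → t₀ * ‖F‖ / 12 ≤ ∫ t in (0:ℝ)..t₀, ‖U t F - Θ (U t F)‖ / 2 := by
  intro E _ _ U Θ F hU0 hUadd hrev hodd hcont t₀ ht₀
  exact odd_persistence_integral U Θ F hU0 hUadd hrev hodd hcont ht₀

end Summit.AtomisticToContinuum.FouriersLaw.Cruxes.OddCorrectorDecay.OddPersistenceLightCone
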